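import Literature.MathematicalPhysics.QuantumFieldTheory.Balaban1983to89.B9PinCarriersKLevelV1R
import Literature.MathematicalPhysics.QuantumFieldTheory.Balaban1983to89.B9PinGeometryKLevelV1B
import Literature.MathematicalPhysics.QuantumFieldTheory.Balaban1983to89.B9Eq335ClassBridgePV1

/-!
# `Balaban1983to89.B9LeafXClassAntitone` — Stage-3′(Y) MODULE 5-R, §5: the N06 leaf `B9LeafX (carriersYR R₁ R₂ ops)` and each of its printed statements are
# ANTITONE IN THE REGULARITY CLASS `(R₁, R₂)` — the leaf-carrier step `bg9Y ⟶ bg9YR R₁ R₂` under ONE displayed class inclusion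

statement-level skeleton of published theorems with citation tags; proofs where landed; nothing here is a claim about the Yang–Mills mass gap

B9 = T. Bałaban, *Propagators for lattice gauge theories in a background field*, Commun. Math. Phys. **99** (1985) 389–434 [Balaban1985BackgroundPropagators].
THE PRINT.  Every theorem of [B9] (Thms 3.1–3.15, Cors 3.5–3.8, (3.49), (3.132)) is a statement *"for U satisfying the regularity conditions (3.35) [(3.36)]
with α₀ sufficiently small …"* (pp. 396–399, 407–410, 413, 416, 422–427, 432): the class enters ONLY AS A HYPOTHESIS on `U`.  Consequently each typed family
statement `B9.…Printed … geo bg …` reads `(bg i).Reg335 ∕ (bg i).Reg336` only in premise position, and is therefore ANTITONE in the class: if every configuration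
of the class `R₁` at threshold `c` (`0 < α₀`) lies in the class `R₁′` at threshold `c′`, the statement over `bg9YR R₁′ R₂′` at `c′` implies the statement over
`bg9YR R₁ R₂` at `c` (same operators, re-typed fieldwise by MODULE 3-R's `kernelFamilyR ∕ siteKernelR ∕ fineKernelR ∕ rwExpansionR ∕ rwKernelExpansionR ∕ hKernelR`).

WHY THIS FILE (pub-ymgap bus 2026-08-28: dag-n06-d g13 road (B) for the STEP-3 R-edition of the N06 certificate — «the ONLY genuine input per RULING-2 (c) is ONE
displayed class inclusion `hY335 : ∀ x α₀ U, (bg9YR … R₁ R₂ x).Reg335 c α₀ U → (bg9Y … x).Reg335 c α₀ U`»; dag-n06-i g29: «the leaf-carrier step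
`Stmt3132Printed ∕ Stmt349Printed … (bg9Y) K → … (bg9YR R₁ R₂) (siteKernelR ∕ fineKernelR K)` under the displayed class-content implication is def-Y's»).
This is that step, ONCE, for every binder of MODULE 5-R's knit `B9PinCarriersKLevelV1R.b9LeafX_carriersYR` and for the leaf itself.

WHAT THIS FILE DOES (all kernel-checked bookkeeping; nothing of [B9] asserted):
* §0 `ClassIncl R c R′ c′ := ∀ x α₀ U, 0 < α₀ → R x c α₀ U → R′ x c′ α₀ U` — the displayed class inclusion ACROSS THRESHOLDS, GUARDED by `0 < α₀` (every
  printed statement quantifies `∀ α₀, 0 < α₀ → …`, and the print-class bridge needs `0 ≤ α₀`); `classIncl_refl` (the Y-closer), `classIncl_trans`, the reading of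
  dag-n06-d's unguarded one-threshold display `classIncl_of_carrier[336]`, and ★ THE PRINT-CLASS INSTANCES `classIncl_regYP335_regY335 : c ≤ 10 → 10·L³ ≤ c′ →
  ClassIncl regYP335 c regY335 c′`, `classIncl_regYP336_regY336` (`10·L⁴ ≤ c′`) = dag-n06-j's `B9Eq335ClassBridgePV1.regY335_of_regYP335 ∕ regY336_of_regYP336`,
  and at the letters `classIncl_regYP335_c35Y_c35B ∕ classIncl_regYP336_c35Y_c35B : ClassIncl regYP33x c35Y regY33x (c35B ℓ)` (MODULE 4B `c35B ℓ = 10·L⁴`).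
* §1 the CLASS-FREE binders transfer by `id` (definitional): `cor35Printed_R`, `residualGpAtOne_R`, `residualGAGlobAtOne_R`, `rwSumsYieldIneqs_R`, `rwKernelSumYields_R`.
* §2 the (3.35)-premised statements are antitone under `ClassIncl R₁ c R₁′ c′` (statement at `(R₁′, c′)` ⇒ statement at `(R₁, c)`; the threshold `c35` enters
  every printed statement ONLY through its (3.35)∕(3.36) premises, except Cor 3.6's smallness `c·M·α₀ ≤ a₁` — transferred with `a₁ ↦ a₁·c∕c′` — and the gauge
  reduction's conclusion radius `c·M·α₀` — kept at one threshold): `thm31Printed_antitone`, `thm32Printed_antitone`, `thm33Printed_antitone`,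
  `thm34Printed_antitone`, `cor36Printed_antitone`, `sectBStepPrinted_antitone`, `gaugeReduction335_antitone`, `thm37Printed_antitone`, `cor38Printed_antitone`,
  `thm39Printed_antitone`, `thm310Printed_antitone`, `thm311Printed_antitone`, `thm314Printed_antitone`, `thm314LocalPrinted_antitone`, `stmt349Printed_antitone`.
* §3 the (3.35)–(3.36)-premised statements are antitone under `ClassIncl R₁ c R₁′ c′`, `ClassIncl R₂ c R₂′ c′`: `thm312Printed_antitone`, `thm313Printed_antitone`,
  `thm315FullPrinted_antitone`, `stmt3132Printed_antitone`.
* §4 (the bundle pins `c35 := c35Y` on both sides) ★★★ `b9Leaf_carriersYR_antitone`, ★★★ `b9LeafX_carriersYR_antitone : ClassIncl R₁ c35Y R₁′ c35Y →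
  ClassIncl R₂ c35Y R₂′ c35Y → B9LeafX (carriersYR … R₁′ R₂′ ops) → B9LeafX (carriersYR … R₁ R₂ ops)`; the reading from MODULE 5's bundle ★★★
  `b9LeafX_carriersYR_of_carriersY : ClassIncl R₁ c35Y (regY335 𝔸 G) c35Y → ClassIncl R₂ c35Y (regY336 𝔸 G) c35Y → B9LeafX (carriersY … ops) → B9LeafX (carriersYR … R₁ R₂ ops)`
  (`carriersY = carriersYR regY335 regY336`, `rfl`).  THE PRINT-CLASS ROAD (dag-n06-d R-EDITION-RECIPE §4, typed): each field of the P-leaf `B9LeafX (carriersYP … ops)`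
  (premise `regYP335 x c35Y α₀ U`) follows FIELD BY FIELD from the corresponding Y-statement AT THRESHOLD `c35B ℓ` by §2–§3 with `classIncl_regYP33x_c35Y_c35B` — no
  constant-blind re-reading of the families is needed:
* §5 ★★★ `b9LeafX_carriersYP_of_statements_at_c35B ops : Cor35Printed … (bg9Y 𝔸 G) … → Cor36Printed (d+1) (c35B ℓ) geo9Y (bg9Y 𝔸 G) … → Thm31Printed (c35B ℓ) … →
  ⋯ → Thm314LocalPrinted (c35B ℓ) … → B9LeafX (carriersYP … ops)` — the nineteen Y-statements with the same operator layer, at threshold `c35B ℓ`, give the N06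
  leaf over PRINT'S class (the mouth of the P-edition; every input displayed).
Every §2–§3 lemma is stated for Y-typed operators (`K x : B9.KernelFamily (geo9Y x) (bg9Y 𝔸 G x)` etc.) re-typed at both pairs of families, so a consumer holding a
statement over `bg9Y 𝔸 G` (= `bg9YR (regY335) (regY336)`, MODULE 3-R `bg9Y_eq_bg9YR`, `rfl`; re-typings the identity there, `kernelFamilyR_regY`) feeds it as is.

HONEST SCOPE.  Monotonicity bookkeeping: quantifier-by-quantifier transport of hypotheses-only class predicates; no inequality, expansion or identity of the paper is
proved or asserted; the only class inclusions proved are `classIncl_refl` and the re-packagings of dag-n06-j's LANDED bridge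
`B9Eq335ClassBridgePV1.regY335_of_regYP335 ∕ regY336_of_regYP336` (nothing new about the classes); nothing landed is modified; N06 is NOT discharged; NOT continuum, NOT OS, NOT the mass gap.  Filed by the pub-ymgap def-Y owner lineage
(`pub-ymgap-node00-def-Y`, gen 24).  Net new unproved facts: 0.
-/

noncomputable section

namespace Literature.MathematicalPhysics.QuantumFieldTheory.Balaban1983to89.B9LeafXClassAntitone

open DagBinding
open B6GlobalChartV1 (PV)
open B9BackgroundsKLevelV1 (CfgV1)
open B9PinMembersKLevelV1 (MemberY geo9Y bg9Y)
open B9BackgroundsKLevelV1R (RegFamY bg9YR regY335 regY336 regYP335 regYP336 kernelFamilyR kernelFamilyRY siteKernelR fineKernelR rwExpansionR rwKernelExpansionR hKernelR hKernelRY)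
open B9PinGeometryKLevelV1 (dOmegaY OmKY inΛY unitDistY InCubeY c35Y c35Y_pos)
open B9PinCarriersKLevelV1 (OperatorLayerY carriersY)
open B9PinCarriersKLevelV1P (carriersYP)
open B9PinCarriersKLevelV1R (carriersYR)
open B9PinGeometryKLevelV1B (c35B c35B_pos ten_L3_le_c35B ten_L4_le_c35B c35Y_le_ten)

variable {d ℓ : ℕ} {hd : 1 ≤ d + 1} {hL : Odd (ℓ + 1) ∧ 1 < ℓ + 1} {b₀ b₁ : ℝ} {Mstar : ℕ}
variable {𝔸 : Type} [NormedRing 𝔸] [NormedAlgebra ℂ 𝔸] [CompleteSpace 𝔸] {G : Subgroup 𝔸ˣ}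

/-! ## §0 The displayed class inclusion -/

section Incl

/-- **CLASS INCLUSION ACROSS THRESHOLDS** (guarded by `0 < α₀`): every configuration of a member in the class `R` at threshold `c` (and `α₀`) lies in the class
`R′` at threshold `c′` (same `α₀`).  At `c′ = c` it is the one displayed class-content hypothesis of the R-edition (dag-n06-d RULING-2 (c)); across thresholds it
is the shape of the print-class bridge `B9Eq335ClassBridgePV1.regY335_of_regYP335` (`c ≤ 10`, `c′ ≥ 10·L³`).  Hypothesis shape; nothing asserted.
[cite: Balaban1985BackgroundPropagators, (3.35)–(3.36) p.396 (the class as a hypothesis on `U`; «O(1) … ≧ 10»)] -/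
def ClassIncl (R : RegFamY d ℓ hd hL b₀ b₁ Mstar 𝔸) (c : ℝ) (R' : RegFamY d ℓ hd hL b₀ b₁ Mstar 𝔸) (c' : ℝ) : Prop :=
  ∀ (x : MemberY d ℓ hd hL b₀ b₁ Mstar) (α₀ : ℝ) (U : CfgV1 (PV d ℓ x.m x.K hd hL) 𝔸), 0 < α₀ → R x c α₀ U → R' x c' α₀ U

omit [NormedAlgebra ℂ 𝔸] [CompleteSpace 𝔸] in
/-- reflexivity (the Y-closer: at MODULE 3's own families and threshold the inclusion is `id`). [cite: Balaban1985BackgroundPropagators, p.396 (bookkeeping)] -/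
theorem classIncl_refl (R : RegFamY d ℓ hd hL b₀ b₁ Mstar 𝔸) (c : ℝ) : ClassIncl R c R c := fun _ _ _ _ h => h

omit [NormedAlgebra ℂ 𝔸] [CompleteSpace 𝔸] in
/-- transitivity. [cite: Balaban1985BackgroundPropagators, p.396 (bookkeeping)] -/
theorem classIncl_trans {R R' R'' : RegFamY d ℓ hd hL b₀ b₁ Mstar 𝔸} {c c' c'' : ℝ} (h : ClassIncl R c R' c') (h' : ClassIncl R' c' R'' c'') :
    ClassIncl R c R'' c'' :=
  fun x α₀ U hα hU => h' x α₀ U hα (h x α₀ U hα hU)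

/-- the unguarded carrier-level display `∀ x α₀ U, (bg9YR … R₁ R₂ x).Reg335 c α₀ U → (bg9YR … R₁′ R₂′ x).Reg335 c α₀ U` (dag-n06-d's `hY335`) gives the inclusion.
[cite: Balaban1985BackgroundPropagators, (3.35) p.396 (bookkeeping)] -/
theorem classIncl_of_carrier {R₁ R₂ R₁' R₂' : RegFamY d ℓ hd hL b₀ b₁ Mstar 𝔸} {c : ℝ}
    (h : ∀ (x : MemberY d ℓ hd hL b₀ b₁ Mstar) (α₀ : ℝ) (U : (bg9YR 𝔸 G R₁ R₂ x).Cfg),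
      (bg9YR 𝔸 G R₁ R₂ x).Reg335 c α₀ U → (bg9YR 𝔸 G R₁' R₂' x).Reg335 c α₀ U) : ClassIncl R₁ c R₁' c :=
  fun x α₀ U _ hU => h x α₀ U hU

/-- the same for (3.36). [cite: Balaban1985BackgroundPropagators, (3.36) p.396 (bookkeeping)] -/
theorem classIncl_of_carrier336 {R₁ R₂ R₁' R₂' : RegFamY d ℓ hd hL b₀ b₁ Mstar 𝔸} {c : ℝ}
    (h : ∀ (x : MemberY d ℓ hd hL b₀ b₁ Mstar) (α₀ : ℝ) (U : (bg9YR 𝔸 G R₁ R₂ x).Cfg),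
      (bg9YR 𝔸 G R₁ R₂ x).Reg336 c α₀ U → (bg9YR 𝔸 G R₁' R₂' x).Reg336 c α₀ U) : ClassIncl R₂ c R₂' c :=
  fun x α₀ U _ hU => h x α₀ U hU

/-- ★ **THE PRINT-CLASS INSTANCE, (3.35)**: print's class («O(1) ≧ 10», MODULE 3-P's `regYP335`) at any `c ≤ 10` is included in MODULE 3's small-cube class `regY335`
at any `c′ ≥ 10·L³` — dag-n06-j's bridge `B9Eq335ClassBridgePV1.regY335_of_regYP335`, read as a `ClassIncl`.
[cite: Balaban1985BackgroundPropagators, (3.35) p.396 («≧ 10»), Thm 3.14 pp.426–427 (both sequences)] -/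
theorem classIncl_regYP335_regY335 {c c' : ℝ} (hc : c ≤ 10) (hc' : 10 * ((ℓ + 1 : ℕ) : ℝ) ^ 3 ≤ c') :
    ClassIncl (regYP335 𝔸 G : RegFamY d ℓ hd hL b₀ b₁ Mstar 𝔸) c (regY335 𝔸 G) c' :=
  fun x _ _ hα hU => B9Eq335ClassBridgePV1.regY335_of_regYP335 x hc hα.le hU hc'

/-- ★ **THE PRINT-CLASS INSTANCE, (3.36)** at `c ≤ 10`, `c′ ≥ 10·L⁴` (dag-n06-j's `regY336_of_regYP336`).
[cite: Balaban1985BackgroundPropagators, (3.35)–(3.36) p.396 («≧ 10»), Thm 3.14 pp.426–427] -/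
theorem classIncl_regYP336_regY336 {c c' : ℝ} (hc : c ≤ 10) (hc' : 10 * ((ℓ + 1 : ℕ) : ℝ) ^ 4 ≤ c') :
    ClassIncl (regYP336 𝔸 G : RegFamY d ℓ hd hL b₀ b₁ Mstar 𝔸) c (regY336 𝔸 G) c' :=
  fun x _ _ hα hU => B9Eq335ClassBridgePV1.regY336_of_regYP336 x hc hα.le hU hc'

/-- ★ AT THE LETTERS: print's class at the record's `c35Y = 10` inside MODULE 3's class at MODULE 4B's bridged threshold `c35B ℓ = 10·L⁴`, (3.35).
[cite: Balaban1985BackgroundPropagators, (3.35) p.396 («≧ 10»)] -/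
theorem classIncl_regYP335_c35Y_c35B : ClassIncl (regYP335 𝔸 G : RegFamY d ℓ hd hL b₀ b₁ Mstar 𝔸) c35Y (regY335 𝔸 G) (c35B ℓ) :=
  classIncl_regYP335_regY335 c35Y_le_ten (ten_L3_le_c35B ℓ)

/-- ★ AT THE LETTERS, (3.36): `regYP336` at `c35Y` inside `regY336` at `c35B ℓ`. [cite: Balaban1985BackgroundPropagators, (3.36) p.396 («≧ 10»)] -/
theorem classIncl_regYP336_c35Y_c35B : ClassIncl (regYP336 𝔸 G : RegFamY d ℓ hd hL b₀ b₁ Mstar 𝔸) c35Y (regY336 𝔸 G) (c35B ℓ) :=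
  classIncl_regYP336_regY336 c35Y_le_ten (ten_L4_le_c35B ℓ)

end Incl

variable {R₁ R₂ R₁' R₂' : RegFamY d ℓ hd hL b₀ b₁ Mstar 𝔸} {c c' : ℝ} {dd : ℕ}

/-! ## §1 The class-free binders: definitional transfer -/

section ClassFree

/-- Corollary 3.5 (a statement at `U′·1`, class-free) over `bg9YR R₁′ R₂′` is the statement over `bg9YR R₁ R₂` (definitionally).
[cite: Balaban1985BackgroundPropagators, Cor. 3.5 p.407 (bookkeeping)] -/
theorem cor35Printed_R (Gp GA : ∀ x : MemberY d ℓ hd hL b₀ b₁ Mstar, B9.KernelFamily (geo9Y x) (bg9Y 𝔸 G x))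
    (Cinv : ∀ x : MemberY d ℓ hd hL b₀ b₁ Mstar, B9.SiteKernel (geo9Y x) (bg9Y 𝔸 G x))
    (h : B9.Cor35Printed dd geo9Y (bg9YR 𝔸 G R₁' R₂') (fun x => kernelFamilyR R₁' R₂' (Gp x)) (fun x => kernelFamilyR R₁' R₂' (GA x))
      (fun x => siteKernelR R₁' R₂' (Cinv x))) :
    B9.Cor35Printed dd geo9Y (bg9YR 𝔸 G R₁ R₂) (fun x => kernelFamilyR R₁ R₂ (Gp x)) (fun x => kernelFamilyR R₁ R₂ (GA x))
      (fun x => siteKernelR R₁ R₂ (Cinv x)) := h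

/-- the residual `G′(1)` entries are class-free. [cite: Balaban1985BackgroundPropagators, (3.43) p.398 + Cor. 3.5 p.407 (bookkeeping)] -/
theorem residualGpAtOne_R (Gp : ∀ x : MemberY d ℓ hd hL b₀ b₁ Mstar, B9.KernelFamily (geo9Y x) (bg9Y 𝔸 G x))
    (h : B9FromB6.ResidualGpAtOne geo9Y (bg9YR 𝔸 G R₁' R₂') (fun x => kernelFamilyR R₁' R₂' (Gp x))) :
    B9FromB6.ResidualGpAtOne geo9Y (bg9YR 𝔸 G R₁ R₂) (fun x => kernelFamilyR R₁ R₂ (Gp x)) := h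

/-- the residual `G(1)` global entries are class-free. [cite: Balaban1985BackgroundPropagators, (3.47) p.398 + Cor. 3.5 p.407 (bookkeeping)] -/
theorem residualGAGlobAtOne_R (GA : ∀ x : MemberY d ℓ hd hL b₀ b₁ Mstar, B9.KernelFamily (geo9Y x) (bg9Y 𝔸 G x))
    (h : B9FromB6.ResidualGAGlobAtOne geo9Y (bg9YR 𝔸 G R₁' R₂') (fun x => kernelFamilyR R₁' R₂' (GA x))) :
    B9FromB6.ResidualGAGlobAtOne geo9Y (bg9YR 𝔸 G R₁ R₂) (fun x => kernelFamilyR R₁ R₂ (GA x)) := h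

/-- the Sect.-C summation leaf is class-free. [cite: Balaban1985BackgroundPropagators, Thm 3.7 proof p.409 + Thm 3.10 proof p.416 (bookkeeping)] -/
theorem rwSumsYieldIneqs_R (E7 E10 : ∀ x : MemberY d ℓ hd hL b₀ b₁ Mstar, B9.RWExpansion (geo9Y x) (bg9Y 𝔸 G x))
    (Gp GA : ∀ x : MemberY d ℓ hd hL b₀ b₁ Mstar, B9.KernelFamily (geo9Y x) (bg9Y 𝔸 G x))
    (h : B9.RWSumsYieldIneqs geo9Y (bg9YR 𝔸 G R₁' R₂') (fun x => rwExpansionR R₁' R₂' (E7 x)) (fun x => rwExpansionR R₁' R₂' (E10 x))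
      (fun x => kernelFamilyR R₁' R₂' (Gp x)) (fun x => kernelFamilyR R₁' R₂' (GA x))) :
    B9.RWSumsYieldIneqs geo9Y (bg9YR 𝔸 G R₁ R₂) (fun x => rwExpansionR R₁ R₂ (E7 x)) (fun x => rwExpansionR R₁ R₂ (E10 x))
      (fun x => kernelFamilyR R₁ R₂ (Gp x)) (fun x => kernelFamilyR R₁ R₂ (GA x)) := h

/-- the kernel-summation leaf for (3.98) is class-free. [cite: Balaban1985BackgroundPropagators, Thm 3.9 p.413 (bookkeeping)] -/
theorem rwKernelSumYields_R (E9 : ∀ x : MemberY d ℓ hd hL b₀ b₁ Mstar, B9.RWKernelExpansion (geo9Y x) (bg9Y 𝔸 G x))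
    (Cinv : ∀ x : MemberY d ℓ hd hL b₀ b₁ Mstar, B9.SiteKernel (geo9Y x) (bg9Y 𝔸 G x))
    (h : B9.RWKernelSumYields dd geo9Y (bg9YR 𝔸 G R₁' R₂') (fun x => rwKernelExpansionR R₁' R₂' (E9 x)) (fun x => siteKernelR R₁' R₂' (Cinv x))) :
    B9.RWKernelSumYields dd geo9Y (bg9YR 𝔸 G R₁ R₂) (fun x => rwKernelExpansionR R₁ R₂ (E9 x)) (fun x => siteKernelR R₁ R₂ (Cinv x)) := h

end ClassFree

/-! ## §2 The (3.35)-premised statements are antitone in the class -/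

section Reg335

/-- Theorem 3.1 as typed is antitone in the class (3.35). [cite: Balaban1985BackgroundPropagators, Thm 3.1 (3.42)–(3.47) pp.397–398] -/
theorem thm31Printed_antitone (h1 : ClassIncl R₁ c R₁' c') (Gp : ∀ x : MemberY d ℓ hd hL b₀ b₁ Mstar, B9.KernelFamily (geo9Y x) (bg9Y 𝔸 G x))
    (h : B9.Thm31Printed c' geo9Y (bg9YR 𝔸 G R₁' R₂') (fun x => kernelFamilyR R₁' R₂' (Gp x))) :
    B9.Thm31Printed c geo9Y (bg9YR 𝔸 G R₁ R₂) (fun x => kernelFamilyR R₁ R₂ (Gp x)) := by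
  obtain ⟨M₁, δ₀, a₀, B₀, Bβ, Bε, Bεβ, hM₁, hδ₀, ha₀, hB₀, H⟩ := h
  exact ⟨M₁, δ₀, a₀, B₀, Bβ, Bε, Bεβ, hM₁, hδ₀, ha₀, hB₀, fun x hM α₀ hα hMa U hU => H x hM α₀ hα hMa U (h1 x α₀ U hα hU)⟩

/-- Theorem 3.2 as typed is antitone in the class (3.35). [cite: Balaban1985BackgroundPropagators, Thm 3.2 (3.48) p.398] -/
theorem thm32Printed_antitone (h1 : ClassIncl R₁ c R₁' c') (Cinv : ∀ x : MemberY d ℓ hd hL b₀ b₁ Mstar, B9.SiteKernel (geo9Y x) (bg9Y 𝔸 G x))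
    (h : B9.Thm32Printed dd c' geo9Y (bg9YR 𝔸 G R₁' R₂') (fun x => siteKernelR R₁' R₂' (Cinv x))) :
    B9.Thm32Printed dd c geo9Y (bg9YR 𝔸 G R₁ R₂) (fun x => siteKernelR R₁ R₂ (Cinv x)) := by
  obtain ⟨M₁, δ₀, a₀, B₀, hM₁, hδ₀, ha₀, hB₀, H⟩ := h
  exact ⟨M₁, δ₀, a₀, B₀, hM₁, hδ₀, ha₀, hB₀, fun x hM α₀ hα hMa U hU => H x hM α₀ hα hMa U (h1 x α₀ U hα hU)⟩

/-- Theorem 3.3 as typed is antitone in the class (3.35). [cite: Balaban1985BackgroundPropagators, Thm 3.3 p.399] -/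
theorem thm33Printed_antitone (h1 : ClassIncl R₁ c R₁' c') (Gp GA : ∀ x : MemberY d ℓ hd hL b₀ b₁ Mstar, B9.KernelFamily (geo9Y x) (bg9Y 𝔸 G x))
    (h : B9.Thm33Printed c' geo9Y (bg9YR 𝔸 G R₁' R₂') (fun x => kernelFamilyR R₁' R₂' (Gp x)) (fun x => kernelFamilyR R₁' R₂' (GA x))) :
    B9.Thm33Printed c geo9Y (bg9YR 𝔸 G R₁ R₂) (fun x => kernelFamilyR R₁ R₂ (Gp x)) (fun x => kernelFamilyR R₁ R₂ (GA x)) := by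
  obtain ⟨M₁, δ₀, a₀, B₀, Bβ, Bε, Bεβ, hM₁, hδ₀, ha₀, hB₀, H⟩ := h
  exact ⟨M₁, δ₀, a₀, B₀, Bβ, Bε, Bεβ, hM₁, hδ₀, ha₀, hB₀, fun x hM α₀ hα hMa U hU => H x hM α₀ hα hMa U (h1 x α₀ U hα hU)⟩

/-- Theorem 3.4 as typed (analyticity read through the re-typing, `kernelFamilyRY ∘ kernelFamilyR = id`) is antitone in the class (3.35).
[cite: Balaban1985BackgroundPropagators, Thm 3.4 pp.399–400] -/
theorem thm34Printed_antitone (h1 : ClassIncl R₁ c R₁' c') (Gp GA : ∀ x : MemberY d ℓ hd hL b₀ b₁ Mstar, B9.KernelFamily (geo9Y x) (bg9Y 𝔸 G x))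
    (IA : ∀ x : MemberY d ℓ hd hL b₀ b₁ Mstar, B9.KernelFamily (geo9Y x) (bg9Y 𝔸 G x) → (bg9Y 𝔸 G x).Cfg → ℝ → Prop)
    (h : B9.Thm34Printed c' geo9Y (bg9YR 𝔸 G R₁' R₂') (fun x => kernelFamilyR R₁' R₂' (Gp x)) (fun x => kernelFamilyR R₁' R₂' (GA x))
      (fun x K => IA x (kernelFamilyRY K))) :
    B9.Thm34Printed c geo9Y (bg9YR 𝔸 G R₁ R₂) (fun x => kernelFamilyR R₁ R₂ (Gp x)) (fun x => kernelFamilyR R₁ R₂ (GA x))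
      (fun x K => IA x (kernelFamilyRY K)) := by
  obtain ⟨a₁, M₁, δ₀, a₀, B₀, Bβ, Bε, Bεβ, ha₁, hM₁, hδ₀, ha₀, hB₀, H⟩ := h
  exact ⟨a₁, M₁, δ₀, a₀, B₀, Bβ, Bε, Bεβ, ha₁, hM₁, hδ₀, ha₀, hB₀,
    fun x hM α₀ α₁ hα hMa hα₁ hα₁a U hU => H x hM α₀ α₁ hα hMa hα₁ hα₁a U (h1 x α₀ U hα hU)⟩

/-- Corollary 3.6 as typed is antitone in the class (3.35) across thresholds `c, c′ > 0` (its smallness side condition `c·M·α₀ ≤ a₁` is met by `a₁ ↦ a₁·c∕c′`).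
[cite: Balaban1985BackgroundPropagators, Cor. 3.6 p.408] -/
theorem cor36Printed_antitone (hc : 0 < c) (hc' : 0 < c') (h1 : ClassIncl R₁ c R₁' c') (InCube : MemberY d ℓ hd hL b₀ b₁ Mstar → Prop)
    (Gp GA : ∀ x : MemberY d ℓ hd hL b₀ b₁ Mstar, B9.KernelFamily (geo9Y x) (bg9Y 𝔸 G x))
    (Cinv : ∀ x : MemberY d ℓ hd hL b₀ b₁ Mstar, B9.SiteKernel (geo9Y x) (bg9Y 𝔸 G x))
    (h : B9.Cor36Printed dd c' geo9Y (bg9YR 𝔸 G R₁' R₂') InCube (fun x => kernelFamilyR R₁' R₂' (Gp x)) (fun x => kernelFamilyR R₁' R₂' (GA x))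
      (fun x => siteKernelR R₁' R₂' (Cinv x))) :
    B9.Cor36Printed dd c geo9Y (bg9YR 𝔸 G R₁ R₂) InCube (fun x => kernelFamilyR R₁ R₂ (Gp x)) (fun x => kernelFamilyR R₁ R₂ (GA x))
      (fun x => siteKernelR R₁ R₂ (Cinv x)) := by
  obtain ⟨a₁, M₁, B₀, δ₀, Bβ, Bε, Bεβ, B₁, δ₁, ha₁, hM₁, hB₀, hδ₀, hB₁, hδ₁, H⟩ := h
  refine ⟨a₁ * c / c', M₁, B₀, δ₀, Bβ, Bε, Bεβ, B₁, δ₁, div_pos (mul_pos ha₁ hc) hc', hM₁, hB₀, hδ₀, hB₁, hδ₁,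
    fun x hIn hM α₀ hα hca U hU => H x hIn hM α₀ hα ?_ U (h1 x α₀ U hα hU)⟩
  have e : c' * (geo9Y x).M * α₀ * c = c * (geo9Y x).M * α₀ * c' := by ring
  exact le_of_mul_le_mul_right (by rw [e]; exact (le_div_iff₀ hc').1 hca) hc

/-- the Sect.-B step as typed (classes (3.37) and the products `U′U` are class-free data of the carrier) is antitone in the class (3.35).
[cite: Balaban1985BackgroundPropagators, Sect. B pp.400–407] -/
theorem sectBStepPrinted_antitone (h1 : ClassIncl R₁ c R₁' c') (Gp GA : ∀ x : MemberY d ℓ hd hL b₀ b₁ Mstar, B9.KernelFamily (geo9Y x) (bg9Y 𝔸 G x))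
    (Cinv : ∀ x : MemberY d ℓ hd hL b₀ b₁ Mstar, B9.SiteKernel (geo9Y x) (bg9Y 𝔸 G x))
    (IA : ∀ x : MemberY d ℓ hd hL b₀ b₁ Mstar, B9.KernelFamily (geo9Y x) (bg9Y 𝔸 G x) → (bg9Y 𝔸 G x).Cfg → ℝ → Prop)
    (h : B9.SectBStepPrinted dd c' geo9Y (bg9YR 𝔸 G R₁' R₂') (fun x => kernelFamilyR R₁' R₂' (Gp x)) (fun x => kernelFamilyR R₁' R₂' (GA x))
      (fun x => siteKernelR R₁' R₂' (Cinv x)) (fun x K => IA x (kernelFamilyRY K))) :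
    B9.SectBStepPrinted dd c geo9Y (bg9YR 𝔸 G R₁ R₂) (fun x => kernelFamilyR R₁ R₂ (Gp x)) (fun x => kernelFamilyR R₁ R₂ (GA x))
      (fun x => siteKernelR R₁ R₂ (Cinv x)) (fun x K => IA x (kernelFamilyRY K)) := by
  intro B₀ δ₀ Bβ Bε Bεβ B₁ δ₁
  obtain ⟨M₀, a₁, a₀', B₀', δ₀', Bβ', Bε', Bεβ', B₁', δ₁', q₁, q₂, q₃, q₄, q₅, q₆, q₇, H⟩ := h B₀ δ₀ Bβ Bε Bεβ B₁ δ₁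
  exact ⟨M₀, a₁, a₀', B₀', δ₀', Bβ', Bε', Bεβ', B₁', δ₁', q₁, q₂, q₃, q₄, q₅, q₆, q₇,
    fun x hM α₀ hα hMa U hU => H x hM α₀ hα hMa U (h1 x α₀ U hα hU)⟩

/-- the gauge reduction of the class (3.35) as typed is antitone in the class AT ONE THRESHOLD (its conclusion reads `c` in the radius `c·M·α₀` of (3.37)).
[cite: Balaban1985BackgroundPropagators, Cor. 3.6 proof p.408] -/
theorem gaugeReduction335_antitone (h1 : ClassIncl R₁ c R₁' c) (InCube : MemberY d ℓ hd hL b₀ b₁ Mstar → Prop)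
    (Gp GA : ∀ x : MemberY d ℓ hd hL b₀ b₁ Mstar, B9.KernelFamily (geo9Y x) (bg9Y 𝔸 G x))
    (Cinv : ∀ x : MemberY d ℓ hd hL b₀ b₁ Mstar, B9.SiteKernel (geo9Y x) (bg9Y 𝔸 G x))
    (h : B9.GaugeReduction335 dd c geo9Y (bg9YR 𝔸 G R₁' R₂') InCube (fun x => kernelFamilyR R₁' R₂' (Gp x)) (fun x => kernelFamilyR R₁' R₂' (GA x))
      (fun x => siteKernelR R₁' R₂' (Cinv x))) :
    B9.GaugeReduction335 dd c geo9Y (bg9YR 𝔸 G R₁ R₂) InCube (fun x => kernelFamilyR R₁ R₂ (Gp x)) (fun x => kernelFamilyR R₁ R₂ (GA x))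
      (fun x => siteKernelR R₁ R₂ (Cinv x)) :=
  fun x hIn α₀ U hα hU => h x hIn α₀ U hα (h1 x α₀ U hα hU)

/-- Theorem 3.7 as typed is antitone in the class (3.35). [cite: Balaban1985BackgroundPropagators, Thm 3.7 (3.90)–(3.92) pp.408–409] -/
theorem thm37Printed_antitone (h1 : ClassIncl R₁ c R₁' c') (E : ∀ x : MemberY d ℓ hd hL b₀ b₁ Mstar, B9.RWExpansion (geo9Y x) (bg9Y 𝔸 G x))
    (h : B9.Thm37Printed c' geo9Y (bg9YR 𝔸 G R₁' R₂') (fun x => rwExpansionR R₁' R₂' (E x))) :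
    B9.Thm37Printed c geo9Y (bg9YR 𝔸 G R₁ R₂) (fun x => rwExpansionR R₁ R₂ (E x)) := by
  obtain ⟨M₂, a₀, hM₂, ha₀, H⟩ := h
  exact ⟨M₂, a₀, hM₂, ha₀, fun x hM α₀ hα hMa U hU => H x hM α₀ hα hMa U (h1 x α₀ U hα hU)⟩

/-- Corollary 3.8 as typed is antitone in the class (3.35). [cite: Balaban1985BackgroundPropagators, Cor. 3.8 (3.93)–(3.94) p.410] -/
theorem cor38Printed_antitone (h1 : ClassIncl R₁ c R₁' c') (E : ∀ x : MemberY d ℓ hd hL b₀ b₁ Mstar, B9.RWExpansion (geo9Y x) (bg9Y 𝔸 G x))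
    (h : B9.Cor38Printed c' geo9Y (bg9YR 𝔸 G R₁' R₂') (fun x => rwExpansionR R₁' R₂' (E x))) :
    B9.Cor38Printed c geo9Y (bg9YR 𝔸 G R₁ R₂) (fun x => rwExpansionR R₁ R₂ (E x)) := by
  obtain ⟨M₂, a₀, δ₀, C, c', hM₂, ha₀, hδ₀, hC, hc', H⟩ := h
  exact ⟨M₂, a₀, δ₀, C, c', hM₂, ha₀, hδ₀, hC, hc', fun x hM α₀ hα hMa U hU => H x hM α₀ hα hMa U (h1 x α₀ U hα hU)⟩

/-- Theorem 3.9 as typed is antitone in the class (3.35). [cite: Balaban1985BackgroundPropagators, Thm 3.9 (3.98)–(3.99) p.413] -/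
theorem thm39Printed_antitone (h1 : ClassIncl R₁ c R₁' c') (E : ∀ x : MemberY d ℓ hd hL b₀ b₁ Mstar, B9.RWKernelExpansion (geo9Y x) (bg9Y 𝔸 G x))
    (h : B9.Thm39Printed dd c' geo9Y (bg9YR 𝔸 G R₁' R₂') (fun x => rwKernelExpansionR R₁' R₂' (E x))) :
    B9.Thm39Printed dd c geo9Y (bg9YR 𝔸 G R₁ R₂) (fun x => rwKernelExpansionR R₁ R₂ (E x)) := by
  obtain ⟨M₂, a₀, δ₀, C, c', hM₂, ha₀, hδ₀, hC, hc', H⟩ := h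
  exact ⟨M₂, a₀, δ₀, C, c', hM₂, ha₀, hδ₀, hC, hc', fun x hM α₀ hα hMa U hU => H x hM α₀ hα hMa U (h1 x α₀ U hα hU)⟩

/-- Theorem 3.10 as typed is antitone in the class (3.35). [cite: Balaban1985BackgroundPropagators, Thm 3.10 (3.107)–(3.108) pp.415–416] -/
theorem thm310Printed_antitone (h1 : ClassIncl R₁ c R₁' c') (E : ∀ x : MemberY d ℓ hd hL b₀ b₁ Mstar, B9.RWExpansion (geo9Y x) (bg9Y 𝔸 G x))
    (h : B9.Thm310Printed c' geo9Y (bg9YR 𝔸 G R₁' R₂') (fun x => rwExpansionR R₁' R₂' (E x))) :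
    B9.Thm310Printed c geo9Y (bg9YR 𝔸 G R₁ R₂) (fun x => rwExpansionR R₁ R₂ (E x)) := by
  obtain ⟨M₂, a₀, δ₀, C, c', hM₂, ha₀, hδ₀, hC, hc', H⟩ := h
  exact ⟨M₂, a₀, δ₀, C, c', hM₂, ha₀, hδ₀, hC, hc', fun x hM α₀ hα hMa U hU => H x hM α₀ hα hMa U (h1 x α₀ U hα hU)⟩

/-- Theorem 3.11 as typed is antitone in the class (3.35). [cite: Balaban1985BackgroundPropagators, Thm 3.11 p.416] -/
theorem thm311Printed_antitone (h1 : ClassIncl R₁ c R₁' c') (PosDef : ∀ x : MemberY d ℓ hd hL b₀ b₁ Mstar, Fin 5 → (bg9Y 𝔸 G x).Cfg → Prop)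
    (h : B9.Thm311Printed c' geo9Y (bg9YR 𝔸 G R₁' R₂') PosDef) : B9.Thm311Printed c geo9Y (bg9YR 𝔸 G R₁ R₂) PosDef := by
  obtain ⟨M₃, a₀, hM₃, ha₀, H⟩ := h
  exact ⟨M₃, a₀, hM₃, ha₀, fun x hM α₀ hα hMa U hU => H x hM α₀ hα hMa U (h1 x α₀ U hα hU)⟩

/-- Theorem 3.14 as typed is antitone in the class (3.35). [cite: Balaban1985BackgroundPropagators, Thm 3.14 (3.154) pp.426–427] -/
theorem thm314Printed_antitone (h1 : ClassIncl R₁ c R₁' c') (Kdiff : ∀ x : MemberY d ℓ hd hL b₀ b₁ Mstar, B9.KernelFamily (geo9Y x) (bg9Y 𝔸 G x))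
    (dOmega : ∀ x : MemberY d ℓ hd hL b₀ b₁ Mstar, (geo9Y x).Site → (geo9Y x).Site → ℝ)
    (h : B9.Thm314Printed c' geo9Y (bg9YR 𝔸 G R₁' R₂') (fun x => kernelFamilyR R₁' R₂' (Kdiff x)) dOmega) :
    B9.Thm314Printed c geo9Y (bg9YR 𝔸 G R₁ R₂) (fun x => kernelFamilyR R₁ R₂ (Kdiff x)) dOmega := by
  obtain ⟨M₅, δ₀, a₀, B₀, hM₅, hδ₀, ha₀, hB₀, H⟩ := h
  exact ⟨M₅, δ₀, a₀, B₀, hM₅, hδ₀, ha₀, hB₀, fun x hM α₀ hα hMa U hU => H x hM α₀ hα hMa U (h1 x α₀ U hα hU)⟩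

/-- Theorem 3.14's local reading as typed is antitone in the class (3.35). [cite: Balaban1985BackgroundPropagators, Thm 3.14 (3.154) pp.426–427] -/
theorem thm314LocalPrinted_antitone (h1 : ClassIncl R₁ c R₁' c') (Kdiff : ∀ x : MemberY d ℓ hd hL b₀ b₁ Mstar, B9.KernelFamily (geo9Y x) (bg9Y 𝔸 G x))
    (OmK : ∀ x : MemberY d ℓ hd hL b₀ b₁ Mstar, (geo9Y x).Site → Prop)
    (dOmega : ∀ x : MemberY d ℓ hd hL b₀ b₁ Mstar, (geo9Y x).Site → (geo9Y x).Site → ℝ)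
    (h : B9Thm314.Thm314LocalPrinted c' geo9Y (bg9YR 𝔸 G R₁' R₂') (fun x => kernelFamilyR R₁' R₂' (Kdiff x)) OmK dOmega) :
    B9Thm314.Thm314LocalPrinted c geo9Y (bg9YR 𝔸 G R₁ R₂) (fun x => kernelFamilyR R₁ R₂ (Kdiff x)) OmK dOmega := by
  obtain ⟨M₅, δ₀, a₀, B₀, Bβ, Bε, Bεβ, hM₅, hδ₀, ha₀, hB₀, H⟩ := h
  exact ⟨M₅, δ₀, a₀, B₀, Bβ, Bε, Bεβ, hM₅, hδ₀, ha₀, hB₀, fun x hM α₀ hα hMa U hU => H x hM α₀ hα hMa U (h1 x α₀ U hα hU)⟩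

/-- the claim (3.49) as typed is antitone in the class (3.35). [cite: Balaban1985BackgroundPropagators, (3.49) p.399] -/
theorem stmt349Printed_antitone (h1 : ClassIncl R₁ c R₁' c') (P : ∀ x : MemberY d ℓ hd hL b₀ b₁ Mstar, B9.FineKernel (geo9Y x) (bg9Y 𝔸 G x))
    (h : B9.Stmt349Printed dd c' geo9Y (bg9YR 𝔸 G R₁' R₂') (fun x => fineKernelR R₁' R₂' (P x))) :
    B9.Stmt349Printed dd c geo9Y (bg9YR 𝔸 G R₁ R₂) (fun x => fineKernelR R₁ R₂ (P x)) := by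
  obtain ⟨M₁, δ₀, a₀, C, hM₁, hδ₀, ha₀, hC, H⟩ := h
  exact ⟨M₁, δ₀, a₀, C, hM₁, hδ₀, ha₀, hC, fun x hM α₀ hα hMa U hU => H x hM α₀ hα hMa U (h1 x α₀ U hα hU)⟩

end Reg335

/-! ## §3 The (3.35)–(3.36)-premised statements are antitone in the pair of classes -/

section Reg336

/-- Theorem 3.12 as typed (random-walk ∕ positivity read through the re-typings) is antitone in the classes (3.35)–(3.36).
[cite: Balaban1985BackgroundPropagators, Thm 3.12 (3.133) pp.422–423] -/
theorem thm312Printed_antitone (h1 : ClassIncl R₁ c R₁' c') (h2 : ClassIncl R₂ c R₂' c')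
    (GD G₁ : ∀ x : MemberY d ℓ hd hL b₀ b₁ Mstar, B9.KernelFamily (geo9Y x) (bg9Y 𝔸 G x))
    (H H₁ : ∀ x : MemberY d ℓ hd hL b₀ b₁ Mstar, B9.HKernel (geo9Y x) (bg9Y 𝔸 G x))
    (HR : ∀ x : MemberY d ℓ hd hL b₀ b₁ Mstar, B9.KernelFamily (geo9Y x) (bg9Y 𝔸 G x) → (bg9Y 𝔸 G x).Cfg → ℝ → Prop)
    (HRH : ∀ x : MemberY d ℓ hd hL b₀ b₁ Mstar, B9.HKernel (geo9Y x) (bg9Y 𝔸 G x) → (bg9Y 𝔸 G x).Cfg → ℝ → Prop)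
    (PK : ∀ x : MemberY d ℓ hd hL b₀ b₁ Mstar, B9.KernelFamily (geo9Y x) (bg9Y 𝔸 G x) → (bg9Y 𝔸 G x).Cfg → Prop)
    (h : B9.Thm312Printed dd c' geo9Y (bg9YR 𝔸 G R₁' R₂') (fun x => kernelFamilyR R₁' R₂' (GD x)) (fun x => kernelFamilyR R₁' R₂' (G₁ x))
      (fun x => hKernelR R₁' R₂' (H x)) (fun x => hKernelR R₁' R₂' (H₁ x)) (fun x K => HR x (kernelFamilyRY K)) (fun x K => HRH x (hKernelRY K))
      (fun x K => PK x (kernelFamilyRY K))) :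
    B9.Thm312Printed dd c geo9Y (bg9YR 𝔸 G R₁ R₂) (fun x => kernelFamilyR R₁ R₂ (GD x)) (fun x => kernelFamilyR R₁ R₂ (G₁ x))
      (fun x => hKernelR R₁ R₂ (H x)) (fun x => hKernelR R₁ R₂ (H₁ x)) (fun x K => HR x (kernelFamilyRY K)) (fun x K => HRH x (hKernelRY K))
      (fun x K => PK x (kernelFamilyRY K)) := by
  obtain ⟨M₄, δ₀, a₀, B₀, Bβ, Bε, Bεβ, hM₄, hδ₀, ha₀, hB₀, HH⟩ := h
  refine ⟨M₄, δ₀, a₀, B₀, Bβ, Bε, Bεβ, hM₄, hδ₀, ha₀, hB₀, fun x hM α₀ hα hMa U hU hU' => ?_⟩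
  obtain ⟨HK, HHk⟩ := HH x hM α₀ hα hMa U (h1 x α₀ U hα hU) (h2 x α₀ U hα hU')
  rw [List.forall_mem_cons, List.forall_mem_singleton] at HK HHk
  refine ⟨?_, ?_⟩
  · rw [List.forall_mem_cons, List.forall_mem_singleton]
    exact ⟨HK.1, HK.2⟩
  · rw [List.forall_mem_cons, List.forall_mem_singleton]
    exact ⟨HHk.1, HHk.2⟩

/-- Theorem 3.13 as typed is antitone in the classes (3.35)–(3.36). [cite: Balaban1985BackgroundPropagators, Thm 3.13 p.426] -/
theorem thm313Printed_antitone (h1 : ClassIncl R₁ c R₁' c') (h2 : ClassIncl R₂ c R₂' c')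
    (GG : ∀ x : MemberY d ℓ hd hL b₀ b₁ Mstar, B9.KernelFamily (geo9Y x) (bg9Y 𝔸 G x))
    (HR : ∀ x : MemberY d ℓ hd hL b₀ b₁ Mstar, B9.KernelFamily (geo9Y x) (bg9Y 𝔸 G x) → (bg9Y 𝔸 G x).Cfg → ℝ → Prop)
    (PK : ∀ x : MemberY d ℓ hd hL b₀ b₁ Mstar, B9.KernelFamily (geo9Y x) (bg9Y 𝔸 G x) → (bg9Y 𝔸 G x).Cfg → Prop)
    (h : B9.Thm313Printed c' geo9Y (bg9YR 𝔸 G R₁' R₂') (fun x => kernelFamilyR R₁' R₂' (GG x)) (fun x K => HR x (kernelFamilyRY K))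
      (fun x K => PK x (kernelFamilyRY K))) :
    B9.Thm313Printed c geo9Y (bg9YR 𝔸 G R₁ R₂) (fun x => kernelFamilyR R₁ R₂ (GG x)) (fun x K => HR x (kernelFamilyRY K))
      (fun x K => PK x (kernelFamilyRY K)) := by
  obtain ⟨M₄, δ₀, a₀, B₀, Bβ, Bε, Bεβ, hM₄, hδ₀, ha₀, hB₀, HH⟩ := h
  exact ⟨M₄, δ₀, a₀, B₀, Bβ, Bε, Bεβ, hM₄, hδ₀, ha₀, hB₀,
    fun x hM α₀ hα hMa U hU hU' => HH x hM α₀ hα hMa U (h1 x α₀ U hα hU) (h2 x α₀ U hα hU')⟩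

/-- the full Theorem 3.15 as typed is antitone in the classes (3.35)–(3.36). [cite: Balaban1985BackgroundPropagators, Thm 3.15 (3.185)–(3.187) p.432] -/
theorem thm315FullPrinted_antitone (h1 : ClassIncl R₁ c R₁' c') (h2 : ClassIncl R₂ c R₂' c')
    (Ck : ∀ x : MemberY d ℓ hd hL b₀ b₁ Mstar, B9.SiteKernel (geo9Y x) (bg9Y 𝔸 G x))
    (inΛ : ∀ x : MemberY d ℓ hd hL b₀ b₁ Mstar, (geo9Y x).Site → Prop)
    (unitDist : ∀ x : MemberY d ℓ hd hL b₀ b₁ Mstar, (geo9Y x).Site → (geo9Y x).Site → ℝ)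
    (GB : ∀ x : MemberY d ℓ hd hL b₀ b₁ Mstar, (bg9Y 𝔸 G x).Cfg → Prop) (HRC : ∀ x : MemberY d ℓ hd hL b₀ b₁ Mstar, (bg9Y 𝔸 G x).Cfg → ℝ → Prop)
    (h : B9.Thm315FullPrinted c' geo9Y (bg9YR 𝔸 G R₁' R₂') (fun x => siteKernelR R₁' R₂' (Ck x)) inΛ unitDist GB HRC) :
    B9.Thm315FullPrinted c geo9Y (bg9YR 𝔸 G R₁ R₂) (fun x => siteKernelR R₁ R₂ (Ck x)) inΛ unitDist GB HRC := by
  obtain ⟨δ₀, a₀, B₀, hδ₀, ha₀, hB₀, HH⟩ := h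
  exact ⟨δ₀, a₀, B₀, hδ₀, ha₀, hB₀, fun x α₀ hα hMa U hU hU' => HH x α₀ hα hMa U (h1 x α₀ U hα hU) (h2 x α₀ U hα hU')⟩

/-- the claim (3.132) as typed is antitone in the classes (3.35)–(3.36). [cite: Balaban1985BackgroundPropagators, (3.132) p.422] -/
theorem stmt3132Printed_antitone (h1 : ClassIncl R₁ c R₁' c') (h2 : ClassIncl R₂ c R₂' c')
    (Q Q₁ : ∀ x : MemberY d ℓ hd hL b₀ b₁ Mstar, B9.SiteKernel (geo9Y x) (bg9Y 𝔸 G x))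
    (h : B9.Stmt3132Printed dd c' geo9Y (bg9YR 𝔸 G R₁' R₂') (fun x => siteKernelR R₁' R₂' (Q x)) (fun x => siteKernelR R₁' R₂' (Q₁ x))) :
    B9.Stmt3132Printed dd c geo9Y (bg9YR 𝔸 G R₁ R₂) (fun x => siteKernelR R₁ R₂ (Q x)) (fun x => siteKernelR R₁ R₂ (Q₁ x)) := by
  obtain ⟨M₄, δ₁, a₀, C, hM₄, hδ₁, ha₀, hC, HH⟩ := h
  exact ⟨M₄, δ₁, a₀, C, hM₄, hδ₁, ha₀, hC, fun x hM α₀ hα hMa U hU hU' => HH x hM α₀ hα hMa U (h1 x α₀ U hα hU) (h2 x α₀ U hα hU')⟩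

end Reg336

/-! ## §4 The N06 leaf at the class-parametric bundle is antitone in the class -/

section Leaf

variable (ops : ∀ x : MemberY d ℓ hd hL b₀ b₁ Mstar, OperatorLayerY d ℓ hd hL b₀ b₁ Mstar 𝔸 G x)

/-- ★★★ **THE FIFTEEN NUMBERED STATEMENTS AT THE BUNDLE ARE ANTITONE IN THE CLASS.** [cite: Balaban1985BackgroundPropagators, Thms 3.1–3.15 pp.397–432 (the class as a hypothesis on `U`)] -/
theorem b9Leaf_carriersYR_antitone (h1 : ClassIncl R₁ c35Y R₁' c35Y) (h2 : ClassIncl R₂ c35Y R₂' c35Y)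
    (h : B9Leaf (carriersYR d ℓ hd hL b₀ b₁ Mstar 𝔸 G R₁' R₂' ops).toPrintedCarriers9) :
    B9Leaf (carriersYR d ℓ hd hL b₀ b₁ Mstar 𝔸 G R₁ R₂ ops).toPrintedCarriers9 where
  c35 := cor35Printed_R (fun x => (ops x).Gp) (fun x => (ops x).GA) (fun x => (ops x).Cinv) h.c35
  c36 := cor36Printed_antitone c35Y_pos c35Y_pos h1 InCubeY (fun x => (ops x).Gp) (fun x => (ops x).GA) (fun x => (ops x).Cinv) h.c36
  t31 := thm31Printed_antitone h1 (fun x => (ops x).Gp) h.t31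
  t32 := thm32Printed_antitone h1 (fun x => (ops x).Cinv) h.t32
  t33 := thm33Printed_antitone h1 (fun x => (ops x).Gp) (fun x => (ops x).GA) h.t33
  t34 := thm34Printed_antitone h1 (fun x => (ops x).Gp) (fun x => (ops x).GA) (fun x => (ops x).IsAnalyticExt) h.t34
  t37 := thm37Printed_antitone h1 (fun x => (ops x).E37) h.t37
  c38 := cor38Printed_antitone h1 (fun x => (ops x).E37) h.c38
  t39 := thm39Printed_antitone h1 (fun x => (ops x).EK39) h.t39
  t310 := thm310Printed_antitone h1 (fun x => (ops x).E310) h.t310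
  t311 := thm311Printed_antitone h1 (fun x => (ops x).PosDef) h.t311
  t312 := thm312Printed_antitone h1 h2 (fun x => (ops x).GD) (fun x => (ops x).G₁) (fun x => (ops x).H) (fun x => (ops x).H₁)
    (fun x => (ops x).HasRWExp) (fun x => (ops x).HasRWExpH) (fun x => (ops x).PosDefK) h.t312
  t313 := thm313Printed_antitone h1 h2 (fun x => (ops x).GG) (fun x => (ops x).HasRWExp) (fun x => (ops x).PosDefK) h.t313
  t314 := thm314Printed_antitone h1 (fun x => (ops x).Kdiff) dOmegaY h.t314
  t315 := thm315FullPrinted_antitone h1 h2 (fun x => (ops x).Ck) inΛY unitDistY (fun x => (ops x).GivenBy3185) (fun x => (ops x).HasRWExpC) h.t315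

/-- ★★★ **THE N06 LEAF AT THE CLASS-PARAMETRIC BUNDLE IS ANTITONE IN THE CLASS**: under the displayed inclusions of `R₁` in `R₁′` and of `R₂` in `R₂′` at the record's
threshold `c35Y`, the extended [B9] leaf at `carriersYR R₁′ R₂′ ops` gives the leaf at `carriersYR R₁ R₂ ops` — the leaf-carrier step of the R-edition, once.
[cite: Balaban1985BackgroundPropagators, Thms 3.1–3.15 pp.397–432, (3.49) p.399, (3.132) p.422 (the class as a hypothesis on `U`)] -/
theorem b9LeafX_carriersYR_antitone (h1 : ClassIncl R₁ c35Y R₁' c35Y) (h2 : ClassIncl R₂ c35Y R₂' c35Y)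
    (h : B9LeafX (carriersYR d ℓ hd hL b₀ b₁ Mstar 𝔸 G R₁' R₂' ops)) : B9LeafX (carriersYR d ℓ hd hL b₀ b₁ Mstar 𝔸 G R₁ R₂ ops) where
  numbered := b9Leaf_carriersYR_antitone ops h1 h2 h.numbered
  s349 := stmt349Printed_antitone h1 (fun x => (ops x).P349) h.s349
  s3132 := stmt3132Printed_antitone h1 h2 (fun x => (ops x).QGQinv) (fun x => (ops x).QG1Qinv) h.s3132
  t314loc := thm314LocalPrinted_antitone h1 (fun x => (ops x).Kdiff) OmKY dOmegaY h.t314loc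

/-- ★★★ **FROM MODULE 5's BUNDLE**: the N06 leaf at `carriersY ops` (MODULE 3's reading of the class) gives the leaf at `carriersYR R₁ R₂ ops` for every pair of
families displayed as INCLUDED IN MODULE 3's (`carriersY = carriersYR regY335 regY336`, `rfl`).  With `R₁ R₂ := regY335, regY336` and `classIncl_refl` it is the
identity. [cite: Balaban1985BackgroundPropagators, Thms 3.1–3.15 pp.397–432 (bookkeeping: two readings of one class)] -/
theorem b9LeafX_carriersYR_of_carriersY (h1 : ClassIncl R₁ c35Y (regY335 𝔸 G) c35Y) (h2 : ClassIncl R₂ c35Y (regY336 𝔸 G) c35Y)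
    (h : B9LeafX (carriersY d ℓ hd hL b₀ b₁ Mstar 𝔸 G ops)) : B9LeafX (carriersYR d ℓ hd hL b₀ b₁ Mstar 𝔸 G R₁ R₂ ops) :=
  b9LeafX_carriersYR_antitone ops h1 h2 ((B9PinCarriersKLevelV1R.b9LeafX_carriersY_iff (ops := ops)).2 h)

end Leaf

/-! ## §5 The print-class leaf from the Y-statements at the bridged threshold `c35B ℓ` -/

section PrintClass

variable (ops : ∀ x : MemberY d ℓ hd hL b₀ b₁ Mstar, OperatorLayerY d ℓ hd hL b₀ b₁ Mstar 𝔸 G x)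

/-- ★★★ **THE N06 LEAF OVER PRINT'S CLASS FROM THE Y-STATEMENTS AT THRESHOLD `c35B ℓ`** (dag-n06-d R-EDITION-RECIPE §4, typed once): the nineteen [B9]
statements over MODULE 3's carrier `bg9Y 𝔸 G` with the SAME operator layer `ops`, Corollary 3.5 as is and the eighteen class-premised ones AT THRESHOLD
`c35B ℓ = 10·L⁴` (MODULE 4B), give the extended leaf at MODULE 5-P's bundle `carriersYP ops` (print's class «O(1) ≧ 10» at the record's `c35Y = 10`) — by
§1–§3 at the print-class instances `classIncl_regYP335_c35Y_c35B ∕ classIncl_regYP336_c35Y_c35B` of dag-n06-j's bridge, and `carriersYP = carriersYR regYP335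
regYP336` (`rfl`).  The mouth of the P-edition: nothing of [B9] asserted; every input displayed.
[cite: Balaban1985BackgroundPropagators, (3.35)–(3.36) p.396 («≧ 10»), Thms 3.1–3.15 pp.397–432, (3.49) p.399, (3.132) p.422 (the class as a hypothesis on `U`)] -/
theorem b9LeafX_carriersYP_of_statements_at_c35B
    (c35 : B9.Cor35Printed (d + 1) geo9Y (bg9Y 𝔸 G) (fun x => (ops x).Gp) (fun x => (ops x).GA) (fun x => (ops x).Cinv))
    (c36 : B9.Cor36Printed (d + 1) (c35B ℓ) geo9Y (bg9Y 𝔸 G) InCubeY (fun x => (ops x).Gp) (fun x => (ops x).GA) (fun x => (ops x).Cinv))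
    (t31 : B9.Thm31Printed (c35B ℓ) geo9Y (bg9Y 𝔸 G) (fun x => (ops x).Gp))
    (t32 : B9.Thm32Printed (d + 1) (c35B ℓ) geo9Y (bg9Y 𝔸 G) (fun x => (ops x).Cinv))
    (t33 : B9.Thm33Printed (c35B ℓ) geo9Y (bg9Y 𝔸 G) (fun x => (ops x).Gp) (fun x => (ops x).GA))
    (t34 : B9.Thm34Printed (c35B ℓ) geo9Y (bg9Y 𝔸 G) (fun x => (ops x).Gp) (fun x => (ops x).GA) (fun x => (ops x).IsAnalyticExt))
    (t37 : B9.Thm37Printed (c35B ℓ) geo9Y (bg9Y 𝔸 G) (fun x => (ops x).E37))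
    (c38 : B9.Cor38Printed (c35B ℓ) geo9Y (bg9Y 𝔸 G) (fun x => (ops x).E37))
    (t39 : B9.Thm39Printed (d + 1) (c35B ℓ) geo9Y (bg9Y 𝔸 G) (fun x => (ops x).EK39))
    (t310 : B9.Thm310Printed (c35B ℓ) geo9Y (bg9Y 𝔸 G) (fun x => (ops x).E310))
    (t311 : B9.Thm311Printed (c35B ℓ) geo9Y (bg9Y 𝔸 G) (fun x => (ops x).PosDef))
    (t312 : B9.Thm312Printed (d + 1) (c35B ℓ) geo9Y (bg9Y 𝔸 G) (fun x => (ops x).GD) (fun x => (ops x).G₁) (fun x => (ops x).H) (fun x => (ops x).H₁)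
      (fun x => (ops x).HasRWExp) (fun x => (ops x).HasRWExpH) (fun x => (ops x).PosDefK))
    (t313 : B9.Thm313Printed (c35B ℓ) geo9Y (bg9Y 𝔸 G) (fun x => (ops x).GG) (fun x => (ops x).HasRWExp) (fun x => (ops x).PosDefK))
    (t314 : B9.Thm314Printed (c35B ℓ) geo9Y (bg9Y 𝔸 G) (fun x => (ops x).Kdiff) dOmegaY)
    (t315 : B9.Thm315FullPrinted (c35B ℓ) geo9Y (bg9Y 𝔸 G) (fun x => (ops x).Ck) inΛY unitDistY (fun x => (ops x).GivenBy3185) (fun x => (ops x).HasRWExpC))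
    (s349 : B9.Stmt349Printed (d + 1) (c35B ℓ) geo9Y (bg9Y 𝔸 G) (fun x => (ops x).P349))
    (s3132 : B9.Stmt3132Printed (d + 1) (c35B ℓ) geo9Y (bg9Y 𝔸 G) (fun x => (ops x).QGQinv) (fun x => (ops x).QG1Qinv))
    (t314loc : B9Thm314.Thm314LocalPrinted (c35B ℓ) geo9Y (bg9Y 𝔸 G) (fun x => (ops x).Kdiff) OmKY dOmegaY) :
    B9LeafX (carriersYP d ℓ hd hL b₀ b₁ Mstar 𝔸 G ops) := by
  have h1 : ClassIncl (regYP335 𝔸 G : RegFamY d ℓ hd hL b₀ b₁ Mstar 𝔸) c35Y (regY335 𝔸 G) (c35B ℓ) := classIncl_regYP335_c35Y_c35B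
  have h2 : ClassIncl (regYP336 𝔸 G : RegFamY d ℓ hd hL b₀ b₁ Mstar 𝔸) c35Y (regY336 𝔸 G) (c35B ℓ) := classIncl_regYP336_c35Y_c35B
  exact (B9PinCarriersKLevelV1R.b9LeafX_carriersYP_iff (ops := ops)).1
    { numbered :=
      { c35 := cor35Printed_R (R₁ := regYP335 𝔸 G) (R₂ := regYP336 𝔸 G) (R₁' := regY335 𝔸 G) (R₂' := regY336 𝔸 G)
          (fun x => (ops x).Gp) (fun x => (ops x).GA) (fun x => (ops x).Cinv) c35
        c36 := cor36Printed_antitone (R₂ := regYP336 𝔸 G) (R₂' := regY336 𝔸 G) c35Y_pos (c35B_pos ℓ) h1 InCubeY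
          (fun x => (ops x).Gp) (fun x => (ops x).GA) (fun x => (ops x).Cinv) c36
        t31 := thm31Printed_antitone (R₂ := regYP336 𝔸 G) (R₂' := regY336 𝔸 G) h1 (fun x => (ops x).Gp) t31
        t32 := thm32Printed_antitone (R₂ := regYP336 𝔸 G) (R₂' := regY336 𝔸 G) h1 (fun x => (ops x).Cinv) t32
        t33 := thm33Printed_antitone (R₂ := regYP336 𝔸 G) (R₂' := regY336 𝔸 G) h1 (fun x => (ops x).Gp) (fun x => (ops x).GA) t33
        t34 := thm34Printed_antitone (R₂ := regYP336 𝔸 G) (R₂' := regY336 𝔸 G) h1 (fun x => (ops x).Gp) (fun x => (ops x).GA)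
          (fun x => (ops x).IsAnalyticExt) t34
        t37 := thm37Printed_antitone (R₂ := regYP336 𝔸 G) (R₂' := regY336 𝔸 G) h1 (fun x => (ops x).E37) t37
        c38 := cor38Printed_antitone (R₂ := regYP336 𝔸 G) (R₂' := regY336 𝔸 G) h1 (fun x => (ops x).E37) c38
        t39 := thm39Printed_antitone (R₂ := regYP336 𝔸 G) (R₂' := regY336 𝔸 G) h1 (fun x => (ops x).EK39) t39
        t310 := thm310Printed_antitone (R₂ := regYP336 𝔸 G) (R₂' := regY336 𝔸 G) h1 (fun x => (ops x).E310) t310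
        t311 := thm311Printed_antitone (R₂ := regYP336 𝔸 G) (R₂' := regY336 𝔸 G) h1 (fun x => (ops x).PosDef) t311
        t312 := thm312Printed_antitone h1 h2 (fun x => (ops x).GD) (fun x => (ops x).G₁) (fun x => (ops x).H) (fun x => (ops x).H₁)
          (fun x => (ops x).HasRWExp) (fun x => (ops x).HasRWExpH) (fun x => (ops x).PosDefK) t312
        t313 := thm313Printed_antitone h1 h2 (fun x => (ops x).GG) (fun x => (ops x).HasRWExp) (fun x => (ops x).PosDefK) t313
        t314 := thm314Printed_antitone (R₂ := regYP336 𝔸 G) (R₂' := regY336 𝔸 G) h1 (fun x => (ops x).Kdiff) dOmegaY t314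
        t315 := thm315FullPrinted_antitone h1 h2 (fun x => (ops x).Ck) inΛY unitDistY (fun x => (ops x).GivenBy3185) (fun x => (ops x).HasRWExpC) t315 }
      s349 := stmt349Printed_antitone (R₂ := regYP336 𝔸 G) (R₂' := regY336 𝔸 G) h1 (fun x => (ops x).P349) s349
      s3132 := stmt3132Printed_antitone h1 h2 (fun x => (ops x).QGQinv) (fun x => (ops x).QG1Qinv) s3132
      t314loc := thm314LocalPrinted_antitone (R₂ := regYP336 𝔸 G) (R₂' := regY336 𝔸 G) h1 (fun x => (ops x).Kdiff) OmKY dOmegaY t314loc }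

end PrintClass

end Literature.MathematicalPhysics.QuantumFieldTheory.Balaban1983to89.B9LeafXClassAntitone

end
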